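import Summits.HodgeConjecture.HodgeConjecture.Theorems.Ring2WeilCoverageRealGeneratorTypes
import Summits.HodgeConjecture.HodgeConjecture.Theorems.Ring2WeilCoverageCyclotomicSignaturesG6
import Summits.HodgeConjecture.HodgeConjecture.Theorems.Ring2WeilCoverageCyclotomicUnconditional
import Summits.HodgeConjecture.HodgeConjecture.Theorems.Ring2WeilCoverageResidueDictionaryRowsA
import HarnessLib

/-!
# Weil-type family coverage — QUADRATIC-SURD TYPES AT LEVEL `21`: every `ℚ(√−3)`-balanced CM type of `ℚ(ζ₂₁)` (the census's NO
# row `(21, √−3)`, the `X₂₁` classes) carries polarisations of the types `(4 + √21)` (degree `125`) and `(2 + √21)` (degree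
# `17³`) — the primes of `ℚ(ζ₂₁)⁺` over the UNRAMIFIED inert primes `5` and `17` — whose polarised CM points lie on the NON-SPLIT
# rows `R2 = (3, ℚ(√−3), 5)` and `(3, ℚ(√−3), 17)` (S-pencil); the `ℚ(√−7)`-balanced types carry neither

research route conditional on HC_CM; not a corollary; Q11.4-sentence-2 already refuted in dim ≥ 3.

Ring 2, WEIL-TYPE FAMILY-COVERAGE CENSUS (`HOME/WEIL-FAMILY-COVERAGE.md` `## b01`, blocks b01.17 (by exact periods: `X₂₁ =
Prim J(y² = x²¹ − 1)` on `R2 = (3, ℚ(√−3), 5)` with type `(1,1,1,5,5,5)` and on `(3, ℚ(√−3), {3,17})` with a type of degree `17³`),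
b01.41 (ramified types, parts 48–52); owner ring2-b01), part 54a of the `Ring2WeilCoverage*` series, on part 53's engine for an
arbitrary real generator.  `ℚ(ζ₂₁)⁺ ∋ θ = (1 + 2ζ⁷)(1 + 2(ζ³ + ζ⁶ + ζ¹²))`, `θ² = 21`, `θ` real (part 8); `5` and `17` have order `6`
mod `21` with `−1` a power, so the primes of `ℚ(ζ₂₁)⁺` above them are INERT in `ℚ(ζ₂₁)`, and they are principal with the surd
generators `ϖ₅ = 4 + θ` (`16 − 21 = −5`), `ϖ₁₇ = 2 + θ` (`4 − 21 = −17`) of NEGATIVE norm — `#{real places with ϖ < 0} = 3` — so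
the principal verdict FLIPS (parts 48/53):

* §0 `add_neg_iff_of_sq`, `re_mul_of_re_eq_zero` (real arithmetic: sign of `c + r` with `r² = D > c²`; real part of a product
  of two purely imaginary numbers) — used again by part 54b;
* `re_sqrtTwentyOne`: **the sign dictionary of `√21`**: `Re σ_t(θ) < 0 ↔ t ∈ {1, 4, 5, 16, 17, 20}` (the subgroup `⟨5⟩ = ker χ₂₁`:
  `θ = i√3·ε₃(t) · i√7·ε₇(t)` is negative where parts 26/27a's two Gauss-sum signs agree) and `(Re σ_t θ)² = 21`, `Im σ_t θ = 0`;
* `signSet_twentyOne_five/_seventeen` (`Re σ_t(ϖ) < 0 ↔ t ∈ {1,4,5,16,17,20}`; `ϖ` real, non-zero), `twistSetA_twentyOne`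
  (`X = N_odd ∆ A = {5, 8, 11, 17, 19, 20}`, `decide`), `span_mul_span_twentyOne_five/_seventeen` (`(ϖ)(ϖ′) = (5)`, `(17)` in `𝓞 K`:
  `N(𝔣₀) = 125`, `17³`);
* **`exists_type_twentyOne_five_sqrt_neg_three`**, **`exists_type_twentyOne_seventeen_sqrt_neg_three`** (EVERY `ℚ(√−3)`-balanced
  `Φ`, every `𝔣₀` with `𝔬𝔣₀ = (ϖ)`: a `Φ`-positive divisor of type `(K; Φ; 𝔣₀)` on `ℂ^Φ/Φ(ℤ[ζ₂₁])`; `|S_Φ ∩ X| ≡ |X ∖ N_K| + 3 =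
  1 + 3`), headlines **`exists_surdType_twentyOne_five/_seventeen_sqrt_neg_three`** (`∃ 𝔣₀`, `𝔬𝔣₀·(ϖ′) = (p)`, `∃ ζ′ …`),
  `not_exists_type_twentyOne_five_sqrt_neg_seven` (the YES row's types: `|S_Φ ∩ X| ≡ 2 + 3` odd).

COMPONENTS (S-pencil, exact hermitian determinants `a = (−1)ⁿ det(δ·Tr_{L/K}(ϖξ ζ^{j−k}))`, `g61/py/component_surd.py`): on the
`ℚ(√−3)`-balanced `ℤ[ζ₂₁]`-tori the type `(4 + √21)` has `a = 125`, `T(a) = {3, 5}` — **the row `R2 = (3, ℚ(√−3), 5)`** — and the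
type `(2 + √21)` has `a = 17³`, `T(a) = {3, 17}`: b01.17's placements of `X₂₁`, now for ALL twenty `ℚ(√−3)`-balanced CM types,
each with an explicit `𝒪_L`-linear polarisation of degree `125` resp. `4913`; on the `ℚ(√−7)`-balanced tori `a = −125, −4913 < 0`.

HONEST FRAMING: torus-level statements about Shimura's divisors of type `(K; Φ; 𝔣₀)` on `ℂ^Φ/Φ(ℤ[ζ₂₁])` [Sh98 §14.3 Prop. 4–5],
elementary arithmetic of `ℤ[ζ₂₁]` and residue combinatorics (`decide`); the component statements are S-pencil (docstrings
only); nothing here is a statement about Hodge classes, `W_K`, general members or HC; `HC_CM` is used nowhere.  No `def`, no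
named fact, no `sorry`.

References: [cite: Shimura1998, §14.3 Prop. 4–5, pp. 103–104]; [cite: vanGeemen1994HodgeAV, Lemma 5.2, Thm. 5.10];
[cite: Washington1997, Lemma 4.8]; census b01.17 / b01.41 (seat-derived).
-/

noncomputable section

open Polynomial NumberField Complex Finset
open scoped Real nonZeroDivisors

namespace Summit.HodgeConjecture.Ring2WeilCoverage.SurdTypesLevel21

open Literature.AlgebraicGeometry.Motives (CMType)
open Literature.AlgebraicGeometry.HodgeTheory (IsCMTypeSet)
open Literature.AlgebraicGeometry.ComplexMultiplication.CyclotomicCMType (isCMTypeSet_residueFilter exists_apply_eq_toCircle)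
open Literature.NumberTheory.ComplexMultiplication
open Summit.HodgeConjecture.Ring2WeilCoverage.RealGeneratorTypes
open Summit.HodgeConjecture.Ring2WeilCoverage.RamifiedTypes (card_inter_mod_two_eq)
open Summit.HodgeConjecture.Ring2WeilCoverage.CyclotomicPrincipalObstruction (coprime_of_apply_eq_toCircle)
open Summit.HodgeConjecture.Ring2WeilCoverage.CMTypeSetOddPositions (two_mul_card_eq_card_units)
open Summit.HodgeConjecture.Ring2WeilCoverage.CyclotomicSignaturesG6
  (exists_units_sign_eq_twentyOne exists_units_sign_eq_twentyEight exists_units_sign_eq_thirtySix)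
open Summit.HodgeConjecture.Ring2WeilCoverage.RealQuadraticUnitNorm
  (sq_sqrtTwentyOne complexConj_sqrtTwentyOne norm_realUnits_pos_twentyOne)
open Summit.HodgeConjecture.Ring2WeilCoverage.CyclotomicUnconditional
  (sq_sqrtSeven complexConj_sqrtSeven sq_sqrtThree complexConj_sqrtThree norm_realUnits_pos_twentyEight
    norm_realUnits_pos_thirtySix)
open Summit.HodgeConjecture.Ring2WeilCoverage.ResidueDictionaryPieces
  (im_embedding_sqrtNegThree_neg_iff im_embedding_sqrtNegSeven_neg_iff im_embedding_sqrtNegOne_neg_iff)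
open Summit.HodgeConjecture.Ring2WeilCoverage.ResidueDictionaryPiecesB (re_embedding_sqrtThree_neg_iff)
open Summit.HodgeConjecture.Ring2WeilCoverage.ResidueDictionaryRowsA
  (nK_twentyOne_sqrt_neg_three nK_twentyOne_sqrt_neg_seven nK_twentyEight_sqrt_neg_one nK_twentyEight_sqrt_neg_seven)

variable {K : Type} [Field K] [NumberField K] {ζ : K}

/-- `𝐞(t) = exp(2πi t/n) ∈ ℂ` (`ZMod.toCircle`). -/
local notation3 (prettyPrint := false) "𝐞 " t:max => ((ZMod.toCircle t : Circle) : ℂ)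

/-! ### §0 Real arithmetic: the sign of `c + θ` (`θ² = D > c²`) and of a product of two Gauss sums -/

/-- For `0 ≤ c`, `c² < D` and `r² = D`: `c + r < 0 ↔ r < 0`, and `c + r ≠ 0`. [folklore] -/
theorem add_neg_iff_of_sq {c r D : ℝ} (hc : 0 ≤ c) (hcD : c ^ 2 < D) (hr : r ^ 2 = D) :
    (c + r < 0 ↔ r < 0) ∧ c + r ≠ 0 := by
  refine ⟨⟨fun h => by nlinarith, fun h => by nlinarith⟩, fun h => ?_⟩
  have : r = -c := by linarith
  rw [this] at hr
  nlinarith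

/-- For `z, w ∈ iℝ` (`Re z = Re w = 0`, `Im z, Im w ≠ 0`): `Re (zw) < 0 ↔ (Im z < 0 ↔ Im w < 0)` and
`(Re (zw))² = (Im z)²(Im w)²` (the product of two Gauss sums `i√p·ε`, `i√q·ε′` is `−√(pq)·εε′`). [folklore] -/
theorem re_mul_of_re_eq_zero {z w : ℂ} (hz : z.re = 0) (hw : w.re = 0) (hz0 : z.im ≠ 0) (hw0 : w.im ≠ 0) :
    ((z * w).re < 0 ↔ (z.im < 0 ↔ w.im < 0)) ∧ (z * w).re ^ 2 = z.im ^ 2 * w.im ^ 2 := by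
  have hre : (z * w).re = -(z.im * w.im) := by rw [Complex.mul_re, hz, hw]; ring
  rw [hre]
  refine ⟨?_, by ring⟩
  rw [neg_lt_zero]
  rcases lt_or_gt_of_ne hz0 with h1 | h1 <;> rcases lt_or_gt_of_ne hw0 with h2 | h2
  · exact ⟨fun _ => ⟨fun _ => h2, fun _ => h1⟩, fun _ => mul_pos_of_neg_of_neg h1 h2⟩
  · exact ⟨fun h => absurd h (not_lt.mpr (mul_nonpos_of_nonpos_of_nonneg h1.le h2.le)),
      fun h => absurd (h.mp h1) (not_lt.mpr h2.le)⟩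
  · exact ⟨fun h => absurd h (not_lt.mpr (mul_nonpos_of_nonneg_of_nonpos h1.le h2.le)),
      fun h => absurd (h.mpr h2) (not_lt.mpr h1.le)⟩
  · exact ⟨fun _ => ⟨fun h => absurd h (not_lt.mpr h1.le), fun h => absurd h (not_lt.mpr h2.le)⟩, fun _ => mul_pos h1 h2⟩

section Level21

/-- the residue set `S_Φ` read at level `21`. -/
local notation3 (prettyPrint := false) "SΦ[" Φ "," z "]" =>
  (Finset.univ.filter fun t : ZMod 21 => ∃ σ ∈ (Φ : CMType K).1, σ (z : K) = 𝐞 t)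

/-- part 53's twisted set `X_A` at level `21`. -/
local notation3 (prettyPrint := false) "XA21 " A:max =>
  (Finset.univ.filter fun t : ZMod 21 => t.val.Coprime 21 ∧
    ¬ (t ∈ (A : Finset (ZMod 21)) ↔ Even (Finset.card (Finset.filter (fun s : ZMod 21 => s.val.Coprime 21 ∧ s.val < t.val) Finset.univ))))

/-- `θ₂₁ = (1 + 2ζ⁷)(1 + 2(ζ³ + ζ⁶ + ζ¹²))` (`θ₂₁² = 21`, real; part 8). -/
local notation3 (prettyPrint := false) "θ21[" z "]" =>
  ((1 + 2 * (z : K) ^ 7) * (1 + 2 * ((z : K) ^ 3 + (z : K) ^ 6 + (z : K) ^ 12)))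

/-- **The sign dictionary of `√21 ∈ ℚ(ζ₂₁)⁺`**: for `φ ζ = 𝐞(t)`, `Re φ(θ₂₁) < 0 ↔ t ∈ {1, 4, 5, 16, 17, 20}` (`= ker χ₂₁ = ⟨5⟩`;
`θ₂₁ = i√3·ε₃ · i√7·ε₇` is negative where the two Gauss-sum signs agree) and `(Re φ θ₂₁)² = 21`, `Im φ θ₂₁ = 0`.
research route conditional on HC_CM; not a corollary; Q11.4-sentence-2 already refuted in dim ≥ 3. [cite: Washington1997, Lemma 4.8] -/
theorem re_sqrtTwentyOne (hζ : IsPrimitiveRoot ζ 21) {φ : K →+* ℂ} {t : ZMod 21} (hφt : φ ζ = 𝐞 t) :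
    ((φ (θ21[ζ])).re < 0 ↔ t ∈ ({1, 4, 5, 16, 17, 20} : Finset (ZMod 21))) ∧ (φ (θ21[ζ])).re ^ 2 = 21 ∧
      (φ (θ21[ζ])).im = 0 := by
  have ht := coprime_of_apply_eq_toCircle hζ hφt
  have k3 := im_embedding_sqrtNegThree_neg_iff (K := K) (n := 21) (by norm_num) hφt ht
  have k7 := im_embedding_sqrtNegSeven_neg_iff (K := K) (n := 21) (by norm_num) hφt ht
  simp only [Nat.reduceDiv, Nat.reduceMul] at k3 k7
  have i3 := nK_twentyOne_sqrt_neg_three hφt ht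
  have i7 := nK_twentyOne_sqrt_neg_seven hφt ht
  have hω : IsPrimitiveRoot (ζ ^ 7) 3 := hζ.pow (by norm_num) (by norm_num)
  have hη : IsPrimitiveRoot (ζ ^ 3) 7 := hζ.pow (by norm_num) (by norm_num)
  have s3 : (φ (1 + 2 * ζ ^ 7)) ^ 2 = -3 := by
    have h3 := hω.geom_sum_eq_zero (by norm_num : 1 < 3)
    simp only [Finset.sum_range_succ, Finset.sum_range_zero, zero_add, pow_zero, pow_one] at h3
    rw [← map_pow, show (1 + 2 * ζ ^ 7) ^ 2 = (-3 : K) by linear_combination (4 : K) * h3, map_neg, map_ofNat]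
  have s7 : (φ (1 + 2 * (ζ ^ 3 + ζ ^ 6 + ζ ^ 12))) ^ 2 = -7 := by
    have h7 := hη.geom_sum_eq_zero (by norm_num : 1 < 7)
    simp only [Finset.sum_range_succ, Finset.sum_range_zero, zero_add, pow_zero, pow_one] at h7
    have hη7 : (ζ ^ 3) ^ 7 = 1 := hη.pow_eq_one
    rw [← map_pow, show (1 + 2 * (ζ ^ 3 + ζ ^ 6 + ζ ^ 12)) ^ 2 = (-7 : K) by
      linear_combination (4 * ζ ^ 3) * hη7 + 8 * h7, map_neg, map_ofNat]
  have y3 : (φ (1 + 2 * ζ ^ 7)).im ^ 2 = 3 := by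
    have := congrArg Complex.re s3
    rw [pow_two, Complex.mul_re, k3.2] at this
    simp only [zero_mul, zero_sub, Complex.neg_re, Complex.re_ofNat, neg_inj] at this
    rw [pow_two]; exact this
  have y7 : (φ (1 + 2 * (ζ ^ 3 + ζ ^ 6 + ζ ^ 12))).im ^ 2 = 7 := by
    have := congrArg Complex.re s7
    rw [pow_two, Complex.mul_re, k7.2] at this
    simp only [zero_mul, zero_sub, Complex.neg_re, Complex.re_ofNat, neg_inj] at this
    rw [pow_two]; exact this
  obtain ⟨hiff, hsq⟩ := re_mul_of_re_eq_zero k3.2 k7.2 k3.1.2 k7.1.2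
  have hdec : ∀ s : ZMod 21, s.val.Coprime 21 →
      ((s ∈ ({2, 5, 8, 11, 17, 20} : Finset (ZMod 21)) ↔ s ∈ ({5, 10, 13, 17, 19, 20} : Finset (ZMod 21))) ↔
        s ∈ ({1, 4, 5, 16, 17, 20} : Finset (ZMod 21))) := by
    decide
  refine ⟨?_, ?_, ?_⟩
  · rw [map_mul, hiff, i3, i7]; exact hdec t ht
  · rw [map_mul, hsq, y3, y7]; norm_num
  · rw [map_mul, Complex.mul_im, k3.2, k7.2]; ring

/-- **`ϖ₅ = 4 + θ₂₁` (a generator of a prime of `ℚ(ζ₂₁)⁺` over `5`, inert in `ℚ(ζ₂₁)`): `Re φ(ϖ₅) < 0 ↔ t ∈ {1,4,5,16,17,20}`**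
(`|Re φ θ₂₁| = √21 > 4`), and `ϖ₅` is real and non-zero.
research route conditional on HC_CM; not a corollary; Q11.4-sentence-2 already refuted in dim ≥ 3. [folklore] -/
theorem signSet_twentyOne_five [IsCMField K] (hζ : IsPrimitiveRoot ζ 21) :
    (∀ (φ : K →+* ℂ) (t : ZMod 21), φ ζ = 𝐞 t →
      ((φ (4 + θ21[ζ])).re < 0 ↔ t ∈ ({1, 4, 5, 16, 17, 20} : Finset (ZMod 21)))) ∧
    IsCMField.complexConj K (4 + θ21[ζ]) = 4 + θ21[ζ] ∧ (4 + θ21[ζ]) ≠ 0 := by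
  refine ⟨fun φ t hφt => ?_, by rw [map_add, map_ofNat, complexConj_sqrtTwentyOne hζ], fun h0 => ?_⟩
  · obtain ⟨hiff, hsq, -⟩ := re_sqrtTwentyOne hζ hφt
    rw [map_add, Complex.add_re, map_ofNat, show ((4 : ℂ)).re = 4 by norm_num, ← hiff]
    exact (add_neg_iff_of_sq (by norm_num) (by norm_num : (4:ℝ) ^ 2 < 21) hsq).1
  · obtain ⟨φ⟩ := (inferInstance : Nonempty (K →+* ℂ))
    obtain ⟨t, -, hφt⟩ := exists_apply_eq_toCircle hζ φ
    obtain ⟨-, hsq, -⟩ := re_sqrtTwentyOne hζ hφt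
    have hne := (add_neg_iff_of_sq (by norm_num) (by norm_num : (4:ℝ) ^ 2 < 21) hsq).2
    apply hne
    have := congrArg Complex.re (congrArg φ h0)
    rw [map_add, map_zero, Complex.add_re, map_ofNat] at this
    simpa using this

/-- **`ϖ₁₇ = 2 + θ₂₁` (a generator of a prime over `17`, inert): the same sign set** (`√21 > 2`); real, non-zero.
research route conditional on HC_CM; not a corollary; Q11.4-sentence-2 already refuted in dim ≥ 3. [folklore] -/
theorem signSet_twentyOne_seventeen [IsCMField K] (hζ : IsPrimitiveRoot ζ 21) :
    (∀ (φ : K →+* ℂ) (t : ZMod 21), φ ζ = 𝐞 t →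
      ((φ (2 + θ21[ζ])).re < 0 ↔ t ∈ ({1, 4, 5, 16, 17, 20} : Finset (ZMod 21)))) ∧
    IsCMField.complexConj K (2 + θ21[ζ]) = 2 + θ21[ζ] ∧ (2 + θ21[ζ]) ≠ 0 := by
  refine ⟨fun φ t hφt => ?_, by rw [map_add, map_ofNat, complexConj_sqrtTwentyOne hζ], fun h0 => ?_⟩
  · obtain ⟨hiff, hsq, -⟩ := re_sqrtTwentyOne hζ hφt
    rw [map_add, Complex.add_re, map_ofNat, show ((2 : ℂ)).re = 2 by norm_num, ← hiff]
    exact (add_neg_iff_of_sq (by norm_num) (by norm_num : (2:ℝ) ^ 2 < 21) hsq).1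
  · obtain ⟨φ⟩ := (inferInstance : Nonempty (K →+* ℂ))
    obtain ⟨t, -, hφt⟩ := exists_apply_eq_toCircle hζ φ
    obtain ⟨-, hsq, -⟩ := re_sqrtTwentyOne hζ hφt
    have hne := (add_neg_iff_of_sq (by norm_num) (by norm_num : (2:ℝ) ^ 2 < 21) hsq).2
    apply hne
    have := congrArg Complex.re (congrArg φ h0)
    rw [map_add, map_zero, Complex.add_re, map_ofNat] at this
    simpa using this

/-- **`X_A = N_odd ∆ A = {5, 8, 11, 17, 19, 20}` at level `21`** for `A = {1, 4, 5, 16, 17, 20}` (`decide`; `|N_odd ∖ X| = 3`: the flip).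
research route conditional on HC_CM; not a corollary; Q11.4-sentence-2 already refuted in dim ≥ 3. [folklore] -/
theorem twistSetA_twentyOne :
    XA21 ({1, 4, 5, 16, 17, 20} : Finset (ZMod 21)) = ({5, 8, 11, 17, 19, 20} : Finset (ZMod 21)) := by
  decide

omit [NumberField K] in
/-- The integer `4 + Θ` of `𝓞 K` coerces to `ϖ₅ = 4 + θ₂₁`. [folklore] -/
theorem coe_surd_twentyOne_four (hζ : IsPrimitiveRoot ζ 21) :
    (((4 + (1 + 2 * hζ.toInteger ^ 7) * (1 + 2 * (hζ.toInteger ^ 3 + hζ.toInteger ^ 6 + hζ.toInteger ^ 12)) : 𝓞 K)) : K) =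
      4 + θ21[ζ] := by
  push_cast
  rfl

omit [NumberField K] in
/-- The integer `2 + Θ` of `𝓞 K` coerces to `ϖ₁₇ = 2 + θ₂₁`. [folklore] -/
theorem coe_surd_twentyOne_two (hζ : IsPrimitiveRoot ζ 21) :
    (((2 + (1 + 2 * hζ.toInteger ^ 7) * (1 + 2 * (hζ.toInteger ^ 3 + hζ.toInteger ^ 6 + hζ.toInteger ^ 12)) : 𝓞 K)) : K) =
      2 + θ21[ζ] := by
  push_cast
  rfl

omit [NumberField K] in
/-- **`(ϖ₅)·(ϖ₅′) = (5)`** in `𝓞 K`, `ϖ₅′ = 4 − θ₂₁` (`16 − 21 = −5`): the type `𝔣₀` with `𝔬𝔣₀ = (ϖ₅)` divides `5` with the conjugate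
surd as cofactor (`N(𝔬𝔣₀) = 5⁶`, `N(𝔣₀) = 125`: a polarisation of degree `125`, elementary divisors `(1,1,1,5,5,5)`).
research route conditional on HC_CM; not a corollary; Q11.4-sentence-2 already refuted in dim ≥ 3. [folklore] -/
theorem span_mul_span_twentyOne_five (hζ : IsPrimitiveRoot ζ 21) :
    Ideal.span {(4 + (1 + 2 * hζ.toInteger ^ 7) * (1 + 2 * (hζ.toInteger ^ 3 + hζ.toInteger ^ 6 + hζ.toInteger ^ 12)) : 𝓞 K)} *
      Ideal.span {(4 - (1 + 2 * hζ.toInteger ^ 7) * (1 + 2 * (hζ.toInteger ^ 3 + hζ.toInteger ^ 6 + hζ.toInteger ^ 12)) : 𝓞 K)} =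
      Ideal.span {(5 : 𝓞 K)} := by
  have hzK : algebraMap (𝓞 K) K hζ.toInteger = ζ := rfl
  rw [Ideal.span_singleton_mul_span_singleton, ← Ideal.span_singleton_neg (5 : 𝓞 K)]
  congr 2
  apply RingOfIntegers.ext
  push_cast; simp only [hzK, map_ofNat]
  linear_combination (-1 : K) * sq_sqrtTwentyOne hζ

omit [NumberField K] in
/-- **`(ϖ₁₇)·(ϖ₁₇′) = (17)`**, `ϖ₁₇′ = 2 − θ₂₁` (`4 − 21 = −17`; `N(𝔣₀) = 17³`, degree `4913`).
research route conditional on HC_CM; not a corollary; Q11.4-sentence-2 already refuted in dim ≥ 3. [folklore] -/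
theorem span_mul_span_twentyOne_seventeen (hζ : IsPrimitiveRoot ζ 21) :
    Ideal.span {(2 + (1 + 2 * hζ.toInteger ^ 7) * (1 + 2 * (hζ.toInteger ^ 3 + hζ.toInteger ^ 6 + hζ.toInteger ^ 12)) : 𝓞 K)} *
      Ideal.span {(2 - (1 + 2 * hζ.toInteger ^ 7) * (1 + 2 * (hζ.toInteger ^ 3 + hζ.toInteger ^ 6 + hζ.toInteger ^ 12)) : 𝓞 K)} =
      Ideal.span {(17 : 𝓞 K)} := by
  have hzK : algebraMap (𝓞 K) K hζ.toInteger = ζ := rfl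
  rw [Ideal.span_singleton_mul_span_singleton, ← Ideal.span_singleton_neg (17 : 𝓞 K)]
  congr 2
  apply RingOfIntegers.ext
  push_cast; simp only [hzK, map_ofNat]
  linear_combination (-1 : K) * sq_sqrtTwentyOne hζ

open scoped Classical in
/-- **ROW `(ℚ(ζ₂₁), ℚ(√−3))` — THE TYPE `(4 + √21)` EXISTS** (→ `R2 = (3, ℚ(√−3), 5)`, S-pencil): for every CM type `Φ` balanced for
`N_K = {2, 5, 8, 11, 17, 20}` and every `𝔣₀` with `𝔬𝔣₀ = (ϖ₅)`, `ℂ^Φ/Φ(ℤ[ζ₂₁])` carries a `Φ`-positive divisor of type `(K; Φ; 𝔣₀)`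
(degree `125`).  `|S_Φ ∩ X| ≡ |X ∖ N_K| + 3 = 1 + 3`.
research route conditional on HC_CM; not a corollary; Q11.4-sentence-2 already refuted in dim ≥ 3. [cite: Shimura1998, §14.3 Prop. 4–5, pp. 103–104] -/
theorem exists_type_twentyOne_five_sqrt_neg_three [IsCMField K] [IsCyclotomicExtension {21} ℚ K]
    (hζ : IsPrimitiveRoot ζ 21) (Φ : CMType K)
    (hbal : 2 * (SΦ[Φ, ζ] ∩ ({2, 5, 8, 11, 17, 20} : Finset (ZMod 21))).card = (SΦ[Φ, ζ]).card)
    {𝔣₀ : Ideal (𝓞 (maximalRealSubfield K))}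
    (h𝔣₀ : 𝔣₀.map (algebraMap (𝓞 (maximalRealSubfield K)) (𝓞 K)) =
      Ideal.span {(4 + (1 + 2 * hζ.toInteger ^ 7) * (1 + 2 * (hζ.toInteger ^ 3 + hζ.toInteger ^ 6 + hζ.toInteger ^ 12)) : 𝓞 K)}) :
    ∃ ζ' : K, IsCMField.complexConj K ζ' = -ζ' ∧ (∀ φ : Φ.1, 0 < (φ.1 ζ').im) ∧
        CMTypeLattice.IsOfType (1 : (FractionalIdeal (𝓞 K)⁰ K)ˣ) ζ' 𝔣₀ := by
  have hg : Nat.totient 21 = 2 * (5 + 1) := by decide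
  obtain ⟨hA, hreal, h0⟩ := signSet_twentyOne_five hζ
  have hP := coe_surd_twentyOne_four hζ
  refine exists_type_of_even' hζ hg hreal h0 hP hA Φ h𝔣₀ (exists_units_sign_eq_twentyOne hζ Φ) ?_
  rw [twistSetA_twentyOne]
  have hS := isCMTypeSet_residueFilter hζ Φ
  have hX : IsCMTypeSet 21 ({5, 8, 11, 17, 19, 20} : Finset (ZMod 21)) := by decide
  have hNK : IsCMTypeSet 21 ({2, 5, 8, 11, 17, 20} : Finset (ZMod 21)) := by decide
  have h1 := card_inter_mod_two_eq hS hX hNK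
  have h2 := two_mul_card_eq_card_units hS
  have hU : (Finset.univ.filter fun t : ZMod 21 => t.val.Coprime 21).card = 12 := by decide
  have h3 : (({5, 8, 11, 17, 19, 20} : Finset (ZMod 21)) \ ({2, 5, 8, 11, 17, 20} : Finset (ZMod 21))).card = 1 := by decide
  rw [Nat.even_iff]
  omega

open scoped Classical in
/-- **ROW `(ℚ(ζ₂₁), ℚ(√−3))` — THE TYPE `(2 + √21)` EXISTS** (→ `(3, ℚ(√−3), 17)`, degree `17³`, S-pencil): for every CM type `Φ`
balanced for `N_K = {2, 5, 8, 11, 17, 20}` and every `𝔣₀` with `𝔬𝔣₀ = (ϖ₁₇)`, a `Φ`-positive divisor of type `(K; Φ; 𝔣₀)`.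
research route conditional on HC_CM; not a corollary; Q11.4-sentence-2 already refuted in dim ≥ 3. [cite: Shimura1998, §14.3 Prop. 4–5, pp. 103–104] -/
theorem exists_type_twentyOne_seventeen_sqrt_neg_three [IsCMField K] [IsCyclotomicExtension {21} ℚ K]
    (hζ : IsPrimitiveRoot ζ 21) (Φ : CMType K)
    (hbal : 2 * (SΦ[Φ, ζ] ∩ ({2, 5, 8, 11, 17, 20} : Finset (ZMod 21))).card = (SΦ[Φ, ζ]).card)
    {𝔣₀ : Ideal (𝓞 (maximalRealSubfield K))}
    (h𝔣₀ : 𝔣₀.map (algebraMap (𝓞 (maximalRealSubfield K)) (𝓞 K)) = Ideal.span {(2 + (1 + 2 * hζ.toInteger ^ 7) * (1 + 2 * (hζ.toInteger ^ 3 + hζ.toInteger ^ 6 + hζ.toInteger ^ 12)) : 𝓞 K)}) :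
    ∃ ζ' : K, IsCMField.complexConj K ζ' = -ζ' ∧ (∀ φ : Φ.1, 0 < (φ.1 ζ').im) ∧
        CMTypeLattice.IsOfType (1 : (FractionalIdeal (𝓞 K)⁰ K)ˣ) ζ' 𝔣₀ := by
  have hg : Nat.totient 21 = 2 * (5 + 1) := by decide
  obtain ⟨hA, hreal, h0⟩ := signSet_twentyOne_seventeen hζ
  have hP := coe_surd_twentyOne_two hζ
  refine exists_type_of_even' hζ hg hreal h0 hP hA Φ h𝔣₀ (exists_units_sign_eq_twentyOne hζ Φ) ?_
  rw [twistSetA_twentyOne]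
  have hS := isCMTypeSet_residueFilter hζ Φ
  have hX : IsCMTypeSet 21 ({5, 8, 11, 17, 19, 20} : Finset (ZMod 21)) := by decide
  have hNK : IsCMTypeSet 21 ({2, 5, 8, 11, 17, 20} : Finset (ZMod 21)) := by decide
  have h1 := card_inter_mod_two_eq hS hX hNK
  have h2 := two_mul_card_eq_card_units hS
  have hU : (Finset.univ.filter fun t : ZMod 21 => t.val.Coprime 21).card = 12 := by decide
  have h3 : (({5, 8, 11, 17, 19, 20} : Finset (ZMod 21)) \ ({2, 5, 8, 11, 17, 20} : Finset (ZMod 21))).card = 1 := by decide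
  rw [Nat.even_iff]
  omega

open scoped Classical in
/-- **ROW `(ℚ(ζ₂₁), ℚ(√−3))`, headline: `∃ 𝔣₀ ⊆ 𝓞 K⁺` with `𝔬𝔣₀·(4 − θ) = (5)` and a `Φ`-positive divisor of type `(K; Φ; 𝔣₀)` on
`ℂ^Φ/Φ(ℤ[ζ₂₁])`** for every `ℚ(√−3)`-balanced CM type `Φ` (degree `125`; S-pencil: on `R2 = (3, ℚ(√−3), 5)`).
research route conditional on HC_CM; not a corollary; Q11.4-sentence-2 already refuted in dim ≥ 3. [cite: Shimura1998, §14.3 Prop. 4–5, pp. 103–104] -/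
theorem exists_surdType_twentyOne_five_sqrt_neg_three [IsCMField K] [IsCyclotomicExtension {21} ℚ K]
    (hζ : IsPrimitiveRoot ζ 21) (Φ : CMType K)
    (hbal : 2 * (SΦ[Φ, ζ] ∩ ({2, 5, 8, 11, 17, 20} : Finset (ZMod 21))).card = (SΦ[Φ, ζ]).card) :
    ∃ 𝔣₀ : Ideal (𝓞 (maximalRealSubfield K)),
      𝔣₀.map (algebraMap (𝓞 (maximalRealSubfield K)) (𝓞 K)) * Ideal.span {(4 - (1 + 2 * hζ.toInteger ^ 7) * (1 + 2 * (hζ.toInteger ^ 3 + hζ.toInteger ^ 6 + hζ.toInteger ^ 12)) : 𝓞 K)} = Ideal.span {(5 : 𝓞 K)} ∧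
      ∃ ζ' : K, IsCMField.complexConj K ζ' = -ζ' ∧ (∀ φ : Φ.1, 0 < (φ.1 ζ').im) ∧
        CMTypeLattice.IsOfType (1 : (FractionalIdeal (𝓞 K)⁰ K)ˣ) ζ' 𝔣₀ := by
  obtain ⟨-, hreal, -⟩ := signSet_twentyOne_five hζ
  have hP := coe_surd_twentyOne_four hζ
  obtain ⟨𝔣₀, h𝔣₀⟩ := exists_ideal_map_eq_span hP hreal
  exact ⟨𝔣₀, by rw [h𝔣₀]; exact span_mul_span_twentyOne_five hζ, exists_type_twentyOne_five_sqrt_neg_three hζ Φ hbal h𝔣₀⟩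

open scoped Classical in
/-- **ROW `(ℚ(ζ₂₁), ℚ(√−3))`, headline for `17`: `∃ 𝔣₀`, `𝔬𝔣₀·(2 − θ) = (17)`, and a `Φ`-positive divisor of type `(K; Φ; 𝔣₀)`** for
every `ℚ(√−3)`-balanced `Φ` (degree `17³`; S-pencil: on `(3, ℚ(√−3), 17)`).
research route conditional on HC_CM; not a corollary; Q11.4-sentence-2 already refuted in dim ≥ 3. [cite: Shimura1998, §14.3 Prop. 4–5, pp. 103–104] -/
theorem exists_surdType_twentyOne_seventeen_sqrt_neg_three [IsCMField K] [IsCyclotomicExtension {21} ℚ K]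
    (hζ : IsPrimitiveRoot ζ 21) (Φ : CMType K)
    (hbal : 2 * (SΦ[Φ, ζ] ∩ ({2, 5, 8, 11, 17, 20} : Finset (ZMod 21))).card = (SΦ[Φ, ζ]).card) :
    ∃ 𝔣₀ : Ideal (𝓞 (maximalRealSubfield K)),
      𝔣₀.map (algebraMap (𝓞 (maximalRealSubfield K)) (𝓞 K)) * Ideal.span {(2 - (1 + 2 * hζ.toInteger ^ 7) * (1 + 2 * (hζ.toInteger ^ 3 + hζ.toInteger ^ 6 + hζ.toInteger ^ 12)) : 𝓞 K)} = Ideal.span {(17 : 𝓞 K)} ∧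
      ∃ ζ' : K, IsCMField.complexConj K ζ' = -ζ' ∧ (∀ φ : Φ.1, 0 < (φ.1 ζ').im) ∧
        CMTypeLattice.IsOfType (1 : (FractionalIdeal (𝓞 K)⁰ K)ˣ) ζ' 𝔣₀ := by
  obtain ⟨-, hreal, -⟩ := signSet_twentyOne_seventeen hζ
  have hP := coe_surd_twentyOne_two hζ
  obtain ⟨𝔣₀, h𝔣₀⟩ := exists_ideal_map_eq_span hP hreal
  exact ⟨𝔣₀, by rw [h𝔣₀]; exact span_mul_span_twentyOne_seventeen hζ,
    exists_type_twentyOne_seventeen_sqrt_neg_three hζ Φ hbal h𝔣₀⟩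

open scoped Classical in
/-- **Row `(ℚ(ζ₂₁), ℚ(√−7))` (YES for principal) does NOT carry the type `(4 + √21)`**: for `Φ` balanced for
`N_K = {5, 10, 13, 17, 19, 20}`, no `Φ`-positive divisor of type `𝔣₀`, `𝔬𝔣₀ = (ϖ₅)` (THEOREM L (i) at 21 + `|S_Φ ∩ X| ≡ 2 + 3`).
research route conditional on HC_CM; not a corollary; Q11.4-sentence-2 already refuted in dim ≥ 3. [cite: Shimura1998, §14.3 Prop. 5, p. 104] -/
theorem not_exists_type_twentyOne_five_sqrt_neg_seven [IsCMField K] [IsCyclotomicExtension {21} ℚ K]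
    (hζ : IsPrimitiveRoot ζ 21) (Φ : CMType K)
    (hbal : 2 * (SΦ[Φ, ζ] ∩ ({5, 10, 13, 17, 19, 20} : Finset (ZMod 21))).card = (SΦ[Φ, ζ]).card)
    {𝔣₀ : Ideal (𝓞 (maximalRealSubfield K))}
    (h𝔣₀ : 𝔣₀.map (algebraMap (𝓞 (maximalRealSubfield K)) (𝓞 K)) = Ideal.span {(4 + (1 + 2 * hζ.toInteger ^ 7) * (1 + 2 * (hζ.toInteger ^ 3 + hζ.toInteger ^ 6 + hζ.toInteger ^ 12)) : 𝓞 K)}) :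
    ¬ ∃ ζ' : K, IsCMField.complexConj K ζ' = -ζ' ∧ (∀ φ : Φ.1, 0 < (φ.1 ζ').im) ∧
        CMTypeLattice.IsOfType (1 : (FractionalIdeal (𝓞 K)⁰ K)ˣ) ζ' 𝔣₀ := by
  have hg : Nat.totient 21 = 2 * (5 + 1) := by decide
  obtain ⟨hA, hreal, h0⟩ := signSet_twentyOne_five hζ
  have hP := coe_surd_twentyOne_four hζ
  refine not_exists_type_of_norm_pos_of_odd' hζ hg hreal h0 hP hA Φ h𝔣₀ (norm_realUnits_pos_twentyOne hζ) ?_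
  rw [twistSetA_twentyOne]
  have hS := isCMTypeSet_residueFilter hζ Φ
  have hX : IsCMTypeSet 21 ({5, 8, 11, 17, 19, 20} : Finset (ZMod 21)) := by decide
  have hNK : IsCMTypeSet 21 ({5, 10, 13, 17, 19, 20} : Finset (ZMod 21)) := by decide
  have h1 := card_inter_mod_two_eq hS hX hNK
  have h2 := two_mul_card_eq_card_units hS
  have hU : (Finset.univ.filter fun t : ZMod 21 => t.val.Coprime 21).card = 12 := by decide
  have h3 : (({5, 8, 11, 17, 19, 20} : Finset (ZMod 21)) \ ({5, 10, 13, 17, 19, 20} : Finset (ZMod 21))).card = 2 := by decide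
  rw [Nat.odd_iff]
  omega

end Level21

end Summit.HodgeConjecture.Ring2WeilCoverage.SurdTypesLevel21

end
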